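import Summits.ResolutionOfSingularities.ResolutionOfSingularities.Theorems.SyzygyFlatteningGlobalisationRegCentreOpen
import Literature.AlgebraicGeometry.Resolution.RegularLocalRingsProofs
import HarnessLib

/-!
# Regular centres generise along `𝒪_v ⊆ 𝒪_w` — `stub_regCentreGeneric`

Crux `SyzygyFlattening.Globalisation` (stmt-ResolutionOfSingularities-17061), line `birth`,
registered stub `stub_regCentreGeneric`: for a proper model `M` of `K/k` (`ProperModel k K`,
`Literature/…/ProperModels.lean`) and `v, w ∈ Zar(K/k)` with `𝒪_v ⊆ 𝒪_w` (so `w` is a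
generisation of `v` in the Zariski–Riemann space), if the local ring of `M` at the centre of `v`
is regular then so is the local ring at the centre of `w`. This is the step of the lead's
TowerCompactness argument that reduces the cover `Zar(K/k) = ⋃ U_m` to the closed points
(`ZariskiRiemannSpace.exists_le_isClosed`).

Proof. Take an affine open `U ∋ centre v` and its chart `A = im (Γ(M, U) → K) ⊆ 𝒪_v ⊆ 𝒪_w`
(the hypothesis of the stub = `stub_centreChart`). By `regCentreOpen_regCentre_iff_locAt`
(`…GlobalisationRegCentreOpen.lean`) at `v` and at `w`, `M.RegCentre v ↔ locAt 𝒪_v A` regular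
and `M.RegCentre w ↔ locAt 𝒪_w A` regular. Now `locAt 𝒪_w A = locAt 𝒪_w (locAt 𝒪_v A)`
(`stub_locAt_locAt`) is the localisation of the regular local ring `locAt 𝒪_v A` at the prime
`𝔪_w ∩ locAt 𝒪_v A` (`isRegularLocalRing_locAt_iff_atPrime`), hence regular by Serre's theorem
(Matsumura, Thm. 19.3, tree `isRegularLocalRing_localization_atPrime`):
`isRegularLocalRing_locAt_of_le`.
-/

noncomputable section

-- single-problem summit: the doubled namespace component `ResolutionOfSingularities` is forced
set_option linter.dupNamespace false

namespace Summit.ResolutionOfSingularities.ResolutionOfSingularities.Theorems.SyzygyFlattening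

open CategoryTheory AlgebraicGeometry TopologicalSpace IsLocalRing
open Literature.AlgebraicGeometry.Resolution

variable {k K : Type} [Field k] [Field K] [Algebra k K]

/-! ## Regularity of `locAt` passes to coarsenings of the valuation ring -/

/-- **Regularity of the local ring at the centre generises.** For `B ⊆ O ≤ O₁`: if
`locAt O B = B_{𝔪_O ∩ B}` is a regular local ring then so is `locAt O₁ B = B_{𝔪_{O₁} ∩ B}` —
the latter is `locAt O₁ (locAt O B)` (`stub_locAt_locAt`), the localisation of the regular local
ring `locAt O B` at a prime, regular by Serre's theorem (Matsumura, Thm. 19.3).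
[cite: Matsumura1987, Thm. 19.3] -/
theorem isRegularLocalRing_locAt_of_le (O O₁ : ValuationSubring K) (hO : O ≤ O₁)
    (B : Subalgebra k K) (h : B.toSubring ≤ O.toSubring)
    (hreg : IsRegularLocalRing ↥(locAt O B)) : IsRegularLocalRing ↥(locAt O₁ B) := by
  have hk : ∀ c : k, algebraMap k K c ∈ O := fun c => h (B.algebraMap_mem c)
  have hC : (locAt O B).toSubring ≤ O₁.toSubring := fun x hx => hO (locAt_le O B h hx)
  rw [← stub_locAt_locAt k K O O₁ B hk hO h, isRegularLocalRing_locAt_iff_atPrime O₁ (locAt O B) hC]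
  haveI : IsRegularLocalRing ↥(locAt O B).toSubring := hreg
  exact isRegularLocalRing_localization_atPrime _ _

/-! ## The registered stub -/

/-- **STUB `stub_regCentreGeneric`.** For a proper model `M` of `K/k` and `𝒪_v ⊆ 𝒪_w`, a
regular centre of `v` forces a regular centre of `w`: through an affine chart
`A = im (Γ(M, U) → K) ⊆ 𝒪_v ⊆ 𝒪_w` at the centre of `v` (the hypothesis, `stub_centreChart`),
`𝒪_{M, centre v} ≅ A_{𝔪_v ∩ A}` and `𝒪_{M, centre w} ≅ A_{𝔪_w ∩ A}`
(`regCentreOpen_regCentre_iff_locAt`), and `A_{𝔪_w ∩ A}` is a localisation of `A_{𝔪_v ∩ A}`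
at a prime, regular by Serre's theorem (Matsumura, Thm. 19.3). [cite: Matsumura1987, Thm. 19.3] -/
theorem stub_regCentreGeneric :
    (∀ (k K : Type) [Field k] [Field K] [Algebra k K]
      (M : ProperModel k K) (v : ZariskiRiemannSpace k K) (U : M.X.Opens) (_hU : IsAffineOpen U)
      (hx : M.centre v ∈ U),
      Function.Injective
          ((M.X.presheaf.stalkSpecializes (genericPoint_specializes (M.centre v)) ≫
            M.funFieldIso.hom).hom) ∧
        ∃ A : Subalgebra k K,
          (A : Set K) = Set.range
            (((M.X.presheaf.stalkSpecializes (genericPoint_specializes (M.centre v)) ≫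
                M.funFieldIso.hom).hom).comp (M.X.presheaf.germ U (M.centre v) hx).hom) ∧
          A.FG ∧ IsFractionRing ↥A K ∧ A.toSubring ≤ v.asValuationSubring.toSubring ∧
          (locAt v.asValuationSubring A).toSubring =
            ((M.X.presheaf.stalkSpecializes (genericPoint_specializes (M.centre v)) ≫
              M.funFieldIso.hom).hom).range) →
    ∀ (k K : Type) [Field k] [Field K]
    [Algebra k K] (M : ProperModel k K) (v w : ZariskiRiemannSpace k K),
      v.asValuationSubring ≤ w.asValuationSubring → M.RegCentre v → M.RegCentre w := by
  intro hchart k K _ _ _ M v w hvw hv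
  -- an affine chart at the centre of `v`
  obtain ⟨U, hU, hxU, -⟩ := exists_isAffineOpen_mem_and_subset (X := M.X) (x := M.centre v)
    (U := ⊤) trivial
  obtain ⟨-, A, hAc, -, -, hle, -⟩ := hchart k K M v U hU hxU
  have hU' : genericPoint M.X ∈ U := centreChart_genericPoint_mem hxU
  -- the carrier of `A` is the image of `Γ(M, U) → K` (independent of the point)
  have hA : A.toSubring =
      (M.X.presheaf.germ U (genericPoint M.X) hU' ≫ M.funFieldIso.hom).hom.range := by
    -- adapted from `isOpen_setOf_regCentre_of_chart` (…GlobalisationRegCentreOpen.lean)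
    refine SetLike.ext' ?_
    rw [Subalgebra.coe_toSubring, hAc, RingHom.coe_range]
    ext z
    constructor
    · rintro ⟨f, rfl⟩
      exact ⟨f, (centreChart_stalkToK_germ M hxU f).symm⟩
    · rintro ⟨f, rfl⟩
      exact ⟨f, centreChart_stalkToK_germ M hxU f⟩
  have hlew : A.toSubring ≤ w.asValuationSubring.toSubring := fun x hx => hvw (hle hx)
  rw [regCentreOpen_regCentre_iff_locAt M hU hU' A hA v hle] at hv
  rw [regCentreOpen_regCentre_iff_locAt M hU hU' A hA w hlew]
  exact isRegularLocalRing_locAt_of_le _ _ hvw A hle hv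

end Summit.ResolutionOfSingularities.ResolutionOfSingularities.Theorems.SyzygyFlattening

end
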